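import Mathlib
import Summits.Ventures.HodgeRepro2.T6N1WitAlg
import Summits.Ventures.HodgeRepro2.T6A1EigenBasis
import Summits.Ventures.HodgeRepro2.T6InterfaceToyN

/-!
# T6N1WitBasis — the eigenbasis of the doubled shadow, the index swap, and the «inl-functional»
(the non-degenerate N1 instance, STATUS l. 11284 (S1), (S3)–(S4); owner t6-p1, gen 3)

* `WitData F`: an eigenbasis `E` of `H¹(B, ℂ)` (t6-p3's `A3Model.EigenBasis`, from
  `A1EigenBasis.exists_eigenBasis`) with its eigenvectors `eK σ ≠ 0`, `E.eB (i, σ) = single i (eK σ)`.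
* `bI D`: the basis of `V × V` made of the two copies of `E.eB`, reindexed by `Fin n` (`n = 48`) so that
  `Module.Basis.ExteriorAlgebra` applies; `Cidx D`: the index involution `inl (i, σ) ↔ inr (i, \bar σ)`, along
  which the conjugation `conj2` of T6N1WitAlg sends basis vectors to non-zero multiples of basis vectors
  (`swapConj_bI`).
* `IU D`: the indices of `U := inl (h10) ⊕ inr (conj h01) = inl (h10) ⊕ inr (h10)` (the CM-type property of the
  face), `IUc D` those of `Ū = C(U)`; `h10_le_span`, `h01_conj_le_span`: the two clauses of the Voisin display
  land in `span (ι '' bI '' IU)`.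
* `lam1 hw0 := intSN hw0 ∘ ⋀(fst)`: the functional on `⋀(V × V)` that is the lead's `∫_S` on the first copy
  and kills every monomial meeting the second copy (`lam1_pull2`, `lam1_ι_inr_mul`).
No `sorry`; standard axioms. §8(d): uses an L-value-free non-vanishing device: NO.
-/

namespace Summit.Ventures.HodgeRepro2.T6.N1Wit

open ExteriorAlgebra Conj A3Model NumberField

variable {K : Type} [Field K] [NumberField K]

/-! ## 1. The eigen-data -/

/-- The eigen-data of the witness: t6-p3's `EigenBasis` built from one eigenvector `eK σ ≠ 0` per
embedding (`A1EigenBasis.exists_eigenBasis`). -/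
structure WitData (F : FaceSetting K) where
  /-- the eigenbasis `e_{i,σ}` of `H¹(B, ℂ)` -/
  E : EigenBasis K
  /-- the eigenvectors of `K ⊗ ℂ` -/
  eK : (K →+* ℂ) → KC K
  /-- `e_{i,σ} = single i (eK σ)` -/
  heB : ∀ (i : Fin 4) (σ : K →+* ℂ), E.eB (i, σ) = LinearMap.single ℂ (fun _ : Fin 4 => KC K) i (eK σ)
  /-- `eK σ ≠ 0` -/
  heK : ∀ σ, eK σ ≠ 0

/-- The eigen-data exist for every face setting. -/
theorem exists_witData (F : FaceSetting K) : Nonempty (WitData F) := by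
  obtain ⟨E, eK, heB, heK, -, -, -⟩ := A1EigenBasis.exists_eigenBasis K F
  exact ⟨⟨E, eK, heB, heK⟩⟩

/-- Coefficient conjugation sends the `σ`-eigenline to the `\bar σ`-eigenline. -/
theorem conjKC_mem_eigenLineK {σ : K →+* ℂ} {v : KC K} (hv : v ∈ eigenLineK K σ) :
    conjKC v ∈ eigenLineK K (ComplexEmbedding.conjugate σ) := by
  intro x
  have h1 : conjKC (Algebra.TensorProduct.includeRight x : KC K) =
      Algebra.TensorProduct.includeRight x := by
    rw [Algebra.TensorProduct.includeRight_apply, conjKC_tmul, map_one]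
  have h2 := hv x
  have h3 := congrArg conjKC h2
  rw [map_mul, h1, conjKC_smul] at h3
  rw [h3, ComplexEmbedding.conjugate_coe_eq]

/-- `conjH1` sends `ℓ_{i,σ}` into `ℓ_{i,\bar σ}`. -/
theorem conjH1_mem_eigenLine {i : Fin 4} {σ : K →+* ℂ} {v : H1C K} (hv : v ∈ eigenLine K i σ) :
    conjH1 v ∈ eigenLine K i (ComplexEmbedding.conjugate σ) := by
  obtain ⟨u, hu, rfl⟩ := hv
  refine ⟨conjKC u, conjKC_mem_eigenLineK hu, ?_⟩
  ext j
  simp only [conjH1_apply, LinearMap.single_apply]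
  by_cases hj : i = j
  · subst hj; simp
  · simp [hj, map_zero]

/-- Coefficient conjugation sends `H^{0,1}` into `H^{1,0}` (the CM-type property of the face). -/
theorem conjH1_mem_h10_of_mem_h01 (F : FaceSetting K) {v : H1C K} (hv : v ∈ h01 F) :
    conjH1 v ∈ h10 F := by
  let S : Submodule ℂ (H1C K) :=
    { carrier := {v | conjH1 v ∈ h10 F}
      add_mem' := fun {a b} ha hb => by
        show conjH1 (a + b) ∈ h10 F
        rw [conjH1_add]; exact Submodule.add_mem _ ha hb
      zero_mem' := by
        show conjH1 0 ∈ h10 F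
        rw [conjH1_zero]; exact Submodule.zero_mem _
      smul_mem' := fun c {a} ha => by
        show conjH1 (c • a) ∈ h10 F
        rw [conjH1_smul]; exact Submodule.smul_mem _ _ ha }
  have hle : h01 F ≤ S := by
    unfold h01
    refine iSup_le fun i => iSup_le fun σ => iSup_le fun hσ => ?_
    intro v hv
    show conjH1 v ∈ h10 F
    have hσ' : ComplexEmbedding.conjugate σ ∈ F.T i :=
      ((F.face.1 i σ).resolve_left fun h => hσ h.1).1
    unfold h10
    exact Submodule.mem_iSup_of_mem i (Submodule.mem_iSup_of_mem (ComplexEmbedding.conjugate σ)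
      (Submodule.mem_iSup_of_mem hσ' (conjH1_mem_eigenLine hv)))
  exact hle hv

namespace WitData

variable {F : FaceSetting K} (D : WitData F)

/-- `eK σ` spans the `σ`-eigenline of `K ⊗ ℂ`. -/
theorem eigenLineK_eq_span (σ : K →+* ℂ) : eigenLineK K σ = Submodule.span ℂ {D.eK σ} := by
  have h := D.E.eigen 0 σ
  rw [D.heB] at h
  unfold eigenLine at h
  have hinj : Function.Injective (LinearMap.single ℂ (fun _ : Fin 4 => KC K) 0) := by
    intro x y hxy
    have := congrArg (fun f => f 0) hxy
    simpa using this
  apply Submodule.map_injective_of_injective hinj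
  rw [h, Submodule.map_span, Set.image_singleton]

/-- `conjH1 e_{i,σ} = c • e_{i,\bar σ}` with `c ≠ 0`. -/
theorem exists_conjH1_eB (i : Fin 4) (σ : K →+* ℂ) :
    ∃ c : ℂ, c ≠ 0 ∧ conjH1 (D.E.eB (i, σ)) = c • D.E.eB (i, ComplexEmbedding.conjugate σ) := by
  have hmem : conjH1 (D.E.eB (i, σ)) ∈ eigenLine K i (ComplexEmbedding.conjugate σ) := by
    rw [D.heB]
    refine ⟨conjKC (D.eK σ), conjKC_mem_eigenLineK ?_, ?_⟩
    · rw [D.eigenLineK_eq_span]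
      exact Submodule.mem_span_singleton_self _
    · ext j
      simp only [conjH1_apply, LinearMap.single_apply]
      by_cases hj : i = j
      · subst hj; simp
      · simp [hj, map_zero]
  rw [D.E.eigen, Submodule.mem_span_singleton] at hmem
  obtain ⟨c, hc⟩ := hmem
  refine ⟨c, ?_, hc.symm⟩
  rintro rfl
  rw [zero_smul] at hc
  have h0 : D.E.eB (i, σ) = 0 := by
    have := congrArg conjH1 hc
    rw [conjH1_conjH1, show conjH1 (0 : H1C K) = 0 from conjH1_zero] at this
    exact this.symm
  exact D.E.eB.ne_zero (i, σ) h0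

/-! ## 2. The doubled index type and the adapted basis -/

/-- The index type of the doubled eigenbasis: two copies of `Fin 4 × Hom(K, ℂ)`. -/
abbrev J (K : Type) [Field K] [NumberField K] : Type := (Fin 4 × (K →+* ℂ)) ⊕ (Fin 4 × (K →+* ℂ))

/-- The number of indices (`= 48` for a sextic field). -/
noncomputable abbrev nJ (K : Type) [Field K] [NumberField K] : ℕ := Fintype.card (J K)

/-- A linear enumeration of the indices. -/
noncomputable def idx (K : Type) [Field K] [NumberField K] : J K ≃ Fin (nJ K) := Fintype.equivFin (J K)

/-- The adapted basis of `V × V`: the two copies of `E.eB`, enumerated by `Fin n`. -/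
noncomputable def bI : Module.Basis (Fin (nJ K)) ℂ (V2 K) := (D.E.eB.prod D.E.eB).reindex (idx K)

/-- `bI` on a first-copy index. -/
theorem bI_inl (i : Fin 4) (σ : K →+* ℂ) :
    D.bI (idx K (Sum.inl (i, σ))) = ((D.E.eB (i, σ), 0) : V2 K) := by
  rw [bI, Module.Basis.reindex_apply, Equiv.symm_apply_apply]
  ext
  · simp
  · simp

/-- `bI` on a second-copy index. -/
theorem bI_inr (i : Fin 4) (σ : K →+* ℂ) :
    D.bI (idx K (Sum.inr (i, σ))) = ((0, D.E.eB (i, σ)) : V2 K) := by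
  rw [bI, Module.Basis.reindex_apply, Equiv.symm_apply_apply]
  ext
  · simp
  · simp

/-- The index swap `inl (i, σ) ↔ inr (i, \bar σ)`. -/
def Cj : J K → J K
  | Sum.inl (i, σ) => Sum.inr (i, ComplexEmbedding.conjugate σ)
  | Sum.inr (i, σ) => Sum.inl (i, ComplexEmbedding.conjugate σ)

/-- `Cj` is an involution. -/
theorem Cj_Cj (j : J K) : Cj (Cj j) = j := by
  rcases j with ⟨i, σ⟩ | ⟨i, σ⟩ <;> simp [Cj]

/-- The index swap on `Fin n`. -/
noncomputable def Cidx (K : Type) [Field K] [NumberField K] (a : Fin (nJ K)) : Fin (nJ K) :=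
  idx K (Cj ((idx K).symm a))

/-- `Cidx` is an involution. -/
theorem Cidx_Cidx (a : Fin (nJ K)) : Cidx K (Cidx K a) = a := by
  simp [Cidx, Cj_Cj]

/-- `Cidx` is injective. -/
theorem Cidx_injective : Function.Injective (Cidx K) :=
  Function.LeftInverse.injective (Cidx_Cidx (K := K))

/-- THE CONJUGATION ON BASIS VECTORS: `C (bI a) = c • bI (Cidx a)`, `c ≠ 0`. -/
theorem exists_swapConj_bI (a : Fin (nJ K)) :
    ∃ c : ℂ, c ≠ 0 ∧ swapConj (D.bI a) = c • D.bI (Cidx K a) := by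
  obtain ⟨j, rfl⟩ := (idx K).surjective a
  rcases j with ⟨i, σ⟩ | ⟨i, σ⟩
  · obtain ⟨c, hc0, hc⟩ := D.exists_conjH1_eB i σ
    refine ⟨c, hc0, ?_⟩
    rw [Cidx, Equiv.symm_apply_apply, Cj, D.bI_inl, D.bI_inr, swapConj_inl, hc, Prod.smul_mk, smul_zero]
  · obtain ⟨c, hc0, hc⟩ := D.exists_conjH1_eB i σ
    refine ⟨c, hc0, ?_⟩
    rw [Cidx, Equiv.symm_apply_apply, Cj, D.bI_inr, D.bI_inl, swapConj_inr, hc, Prod.smul_mk, smul_zero]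

/-! ## 3. The indices of `U = inl (h10) ⊕ inr (h10)` and the subspace `H10 = ι(U)` -/

/-- `inU F j`: the index `j` (either copy) has its embedding in the CM type of its vertex. -/
def inU (F : FaceSetting K) : J K → Prop
  | Sum.inl (i, σ) => σ ∈ F.T i
  | Sum.inr (i, σ) => σ ∈ F.T i

/-- The swap exchanges `U`-indices and `Ū`-indices (the CM-type property of the face). -/
theorem inU_Cj_iff (j : J K) : inU F (Cj j) ↔ ¬ inU F j := by
  rcases j with ⟨i, σ⟩ | ⟨i, σ⟩
  · show ComplexEmbedding.conjugate σ ∈ F.T i ↔ ¬ σ ∈ F.T i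
    have h := F.face.1 i σ
    constructor
    · intro h1 h2
      rcases h with ⟨-, h3⟩ | ⟨-, h3⟩
      · exact h3 h1
      · exact h3 h2
    · intro h1; exact (h.resolve_left fun h2 => h1 h2.1).1
  · show ComplexEmbedding.conjugate σ ∈ F.T i ↔ ¬ σ ∈ F.T i
    have h := F.face.1 i σ
    constructor
    · intro h1 h2
      rcases h with ⟨-, h3⟩ | ⟨-, h3⟩
      · exact h3 h1
      · exact h3 h2
    · intro h1; exact (h.resolve_left fun h2 => h1 h2.1).1

open Classical in
/-- The `U`-indices, as a finset of `Fin n`. -/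
noncomputable def IU (F : FaceSetting K) : Finset (Fin (nJ K)) :=
  Finset.univ.filter fun a => inU F ((idx K).symm a)

/-- Membership in `IU`. -/
theorem mem_IU (a : Fin (nJ K)) : a ∈ IU F ↔ inU F ((idx K).symm a) := by
  simp [IU]

/-- `idx (inl (i, σ)) ∈ IU` iff `σ ∈ T i`. -/
theorem idx_inl_mem_IU (i : Fin 4) (σ : K →+* ℂ) : idx K (Sum.inl (i, σ)) ∈ IU F ↔ σ ∈ F.T i := by
  rw [mem_IU, Equiv.symm_apply_apply]; rfl

/-- `idx (inr (i, σ)) ∈ IU` iff `σ ∈ T i`. -/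
theorem idx_inr_mem_IU (i : Fin 4) (σ : K →+* ℂ) : idx K (Sum.inr (i, σ)) ∈ IU F ↔ σ ∈ F.T i := by
  rw [mem_IU, Equiv.symm_apply_apply]; rfl

/-- The swap sends `U`-indices to `Ū`-indices and back. -/
theorem Cidx_mem_IU_iff (a : Fin (nJ K)) : Cidx K a ∈ IU F ↔ a ∉ IU F := by
  rw [mem_IU, mem_IU, Cidx, Equiv.symm_apply_apply, inU_Cj_iff]

/-- `H10 := ι(U)`, the span of the generators `ι (bI a)`, `a ∈ IU`. -/
noncomputable def H10 : Submodule ℂ (HS2 K) :=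
  Submodule.span ℂ ((fun a => ι ℂ (D.bI a)) '' (IU F : Set (Fin (nJ K))))

/-- The generators of `H10`. -/
theorem ι_bI_mem_H10 {a : Fin (nJ K)} (ha : a ∈ IU F) : ι ℂ (D.bI a) ∈ D.H10 :=
  Submodule.subset_span ⟨a, ha, rfl⟩

/-- The Voisin clause for `H^{1,0}`: `f^*(ι v) ∈ H10` for `v ∈ h10`. -/
theorem pull2_ι_mem_H10 {v : H1C K} (hv : v ∈ h10 F) : pull2 (ι ℂ v) ∈ D.H10 := by
  rw [pull2_ι]
  have hle : h10 F ≤ D.H10.comap ((ι ℂ : V2 K →ₗ[ℂ] HS2 K) ∘ₗ LinearMap.inl ℂ (H1C K) (H1C K)) := by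
    unfold h10
    refine iSup_le fun i => iSup_le fun σ => iSup_le fun hσ => ?_
    rw [D.E.eigen, Submodule.span_le]
    rintro _ rfl
    show ι ℂ ((D.E.eB (i, σ), 0) : V2 K) ∈ D.H10
    rw [← D.bI_inl]
    exact D.ι_bI_mem_H10 ((idx_inl_mem_IU i σ).2 hσ)
  exact hle hv

/-- The generators `ι (0, w)`, `w ∈ h10`, lie in `H10`. -/
theorem ι_inr_mem_H10 {w : H1C K} (hw : w ∈ h10 F) : ι ℂ ((0, w) : V2 K) ∈ D.H10 := by
  have hle : h10 F ≤ D.H10.comap ((ι ℂ : V2 K →ₗ[ℂ] HS2 K) ∘ₗ LinearMap.inr ℂ (H1C K) (H1C K)) := by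
    unfold h10
    refine iSup_le fun i => iSup_le fun σ => iSup_le fun hσ => ?_
    rw [D.E.eigen, Submodule.span_le]
    rintro _ rfl
    show ι ℂ ((0, D.E.eB (i, σ)) : V2 K) ∈ D.H10
    rw [← D.bI_inr]
    exact D.ι_bI_mem_H10 ((idx_inr_mem_IU i σ).2 hσ)
  exact hle hw

/-- The Voisin clause for `H^{0,1}`: `conj (f^*(ι v)) ∈ H10` for `v ∈ h01`. -/
theorem conj2_pull2_ι_mem_H10 {v : H1C K} (hv : v ∈ h01 F) : conj2 (pull2 (ι ℂ v)) ∈ D.H10 := by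
  rw [conj2_pull2_ι]
  exact D.ι_inr_mem_H10 (conjH1_mem_h10_of_mem_h01 F hv)

end WitData

/-! ## 4. The «inl-functional» `λ₁ = ∫_S^{lead} ∘ ⋀(fst)` -/

/-- `λ₁ := intSN ∘ ⋀(fst)`: the lead's `∫_S` read on the first copy, zero on everything meeting the
second copy. -/
noncomputable def lam1 {w : KC K} (hw0 : w ≠ 0) : HS2 K →ₗ[ℂ] ℂ :=
  ToyN.intSN hw0 ∘ₗ (ExteriorAlgebra.map (LinearMap.fst ℂ (H1C K) (H1C K))).toLinearMap

/-- `⋀(fst) ∘ f^* = id`. -/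
theorem map_fst_pull2 (x : HBC K) :
    ExteriorAlgebra.map (LinearMap.fst ℂ (H1C K) (H1C K)) (pull2 x) = x := by
  have h := congrArg (fun f : HBC K →ₐ[ℂ] HBC K => f x)
    (ExteriorAlgebra.map_comp_map (LinearMap.inl ℂ (H1C K) (H1C K)) (LinearMap.fst ℂ (H1C K) (H1C K)))
  simp only [AlgHom.comp_apply] at h
  rw [pull2]
  rw [h, LinearMap.fst_comp_inl, ExteriorAlgebra.map_id]
  rfl

/-- `λ₁ ∘ f^* = ∫_S^{lead}` (the projection formula input). -/
theorem lam1_pull2 {w : KC K} (hw0 : w ≠ 0) (x : HBC K) :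
    lam1 hw0 (pull2 x) = ToyN.intSN hw0 x := by
  simp only [lam1, LinearMap.comp_apply, AlgHom.toLinearMap_apply]
  rw [map_fst_pull2]

/-- `⋀(fst)` kills the generators of the second copy. -/
theorem map_fst_ι_inr (v : H1C K) :
    ExteriorAlgebra.map (LinearMap.fst ℂ (H1C K) (H1C K)) (ι ℂ ((0, v) : V2 K)) = 0 := by
  rw [ExteriorAlgebra.map_apply_ι]
  simp

/-- `λ₁` kills every product with a second-copy generator in the middle. -/
theorem lam1_mul_ι_inr_mul {w : KC K} (hw0 : w ≠ 0) (a b : HS2 K) (v : H1C K) :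
    lam1 hw0 (a * ι ℂ ((0, v) : V2 K) * b) = 0 := by
  simp only [lam1, LinearMap.comp_apply, AlgHom.toLinearMap_apply, map_mul, map_fst_ι_inr, mul_zero,
    zero_mul, map_zero]

/-- `λ₁` kills every product with a second-copy generator in front. -/
theorem lam1_ι_inr_mul {w : KC K} (hw0 : w ≠ 0) (b : HS2 K) (v : H1C K) :
    lam1 hw0 (ι ℂ ((0, v) : V2 K) * b) = 0 := by
  simpa using lam1_mul_ι_inr_mul hw0 1 b v


end Summit.Ventures.HodgeRepro2.T6.N1Wit
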